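import Literature.Geometry.Lorentzian.ConformalEquationAsymptotics
import Literature.Analysis.PDE.DecayBootstrapLp
import HarnessLib

/-!
# The expansion `v̂ = A/r + O₂(r⁻²)` for `Δ_h v − (R/8) v = R/8` on an `O₃(r⁻²)` end
# (Schoen–Yau 1979, Lemma 3.2 along the Ricci variation)

Schoen–Yau, Comm. Math. Phys. 65 (1979), proof of Thm. 2 (pp. 72–74): Lemma 3.3 is applied to
the metrics `ds²_t = ds² + t Ric`. Their chart components are `δ + O₃(r⁻²)` only (two derivatives
are spent on `Ric`), so the scalar curvature `R_t` has **one** controlled derivative, whereas the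
companion file `ConformalEquationAsymptotics.lean` (`endValue_expansion_of_conformal_solution`,
for `h − δ = o₅(r⁻²)`) runs the flat decay bootstrap `decay_bootstrap`, whose top level consumes
`∂²R`. This file re-runs the same pipeline with the `L⁶` top level
(`Literature.Analysis.PDE.decay_bootstrap_six`, Calderón–Zygmund and Morrey in place of
`H⁴ ⊂ C²`):

* `exists_partial_bounds_of_isBigOSmooth_one` — pointwise bounds for a symbol in `O_1(r^a)` and
  its first partial derivatives;
* `AFEnd.exists_bootstrapCoeff_three` — coefficient bounds of the chart equation on an
  `O₃(r⁻²)` end (values and first partials);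
* `exists_sourceBounds_one` — `∫_{B̄(x,|x|/4)} g² ≤ K|x|⁻⁵`, `∫ (∂g)² ≤ K|x|⁻⁷`, `|∂g| ≤ K|x|⁻⁵`
  on the ball, for `g ∈ O_1(r⁻⁴)`;
* `AFEnd.bootstrap_stage_three` — one run of `decay_bootstrap_six` for the chart equation;
* `AFEnd.isBigOSmooth_monopoleError_three` — the monopole error is `O_1(r⁻⁵)`;
* `endValue_expansion_of_solution_three` — **for every smooth `v ∈ L⁶(dV_h)` solving
  `Δ_h v − (R/8) v = R/8` on data whose end satisfies `h − δ ∈ O₃(r⁻²)` there is `A` with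
  `‖∂^m (v̂ − A/r)(x)‖ = O(|x|^{−2−m})`, `m ≤ 2`** — the proof of
  `endValue_expansion_of_conformal_solution` verbatim with the three replacements above (the
  bounded first moments of `R∘Φ`, `exists_monopole_of_laplacian`, only need `h − δ = O₂(r⁻²)`).

Everything here is proved; nothing is defined and no named fact is introduced.

## References

* R. Schoen, S.-T. Yau, *On the proof of the positive mass conjecture in general relativity*,
  Comm. Math. Phys. 65 (1979) 45–76, Lemma 3.2 (3.5)–(3.20), pp. 64–70; proof of Thm. 2,
  pp. 72–74. [SchoenYauPMT1979]
-/

noncomputable section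

set_option maxSynthPendingDepth 3

open Set Function Filter Metric MeasureTheory Measure TopologicalSpace Bornology Asymptotics Manifold Bundle
open scoped Topology Manifold ContDiff RealInnerProductSpace Laplacian ENNReal

namespace Literature.Geometry.Lorentzian

open Literature.Analysis.PDE (norm_ge_of_mem_closedBall rpow_neg_le_of_mem_closedBall
  partials_congr_of_eventuallyEq laplacian_eq_sum_of_contDiffAt decay_bootstrap_six
  fderiv_fderiv_apply_eq_fderiv_fderiv)
open Literature.Analysis.Potential (isBigO_inv_norm_of_laplacian_decay
  isBigO_sub_integral_laplacian_mul_inv_norm)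
open InnerProductSpace (laplacian_congr_nhds)

/-! ### Symbols of order one: pointwise bounds -/

section SymbolOne

variable {E : Type*} [NormedAddCommGroup E] [InnerProductSpace ℝ E] {a : ℝ} {f : E → ℝ}

/-- **Pointwise bounds for a symbol in `O_1(r^a)` and its first partial derivatives along unit
vectors**: `|f(y)| ≤ C‖y‖^a`, `|∂ᵥf(y)| ≤ C‖y‖^{a−1}` far out, `f` smooth there. [folklore] -/
theorem exists_partial_bounds_of_isBigOSmooth_one (hf : IsBigOSmooth 1 a f) :
    ∃ C r₀ : ℝ, 0 ≤ C ∧ ∀ y : E, r₀ ≤ ‖y‖ →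
      ContDiffAt ℝ ∞ f y ∧ |f y| ≤ C * ‖y‖ ^ a ∧
      (∀ v : E, ‖v‖ ≤ 1 → |fderiv ℝ f y v| ≤ C * ‖y‖ ^ (a - 1)) := by
  obtain ⟨C₀, r₀, hC₀, h₀⟩ := exists_norm_iteratedFDeriv_le_of_isBigOSmooth hf (m := 0) (by norm_num)
  obtain ⟨C₁, r₁, hC₁, h₁⟩ := exists_norm_iteratedFDeriv_le_of_isBigOSmooth hf (m := 1) le_rfl
  obtain ⟨R₀, hR₀⟩ := hf.eventually_contDiffAt
  refine ⟨max C₀ C₁, max (max r₀ r₁) (R₀ + 1), by positivity, fun y hy => ?_⟩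
  have hy0 : r₀ ≤ ‖y‖ := le_trans (le_max_left _ _) ((le_max_left _ _).trans hy)
  have hy1 : r₁ ≤ ‖y‖ := le_trans (le_max_right _ _) ((le_max_left _ _).trans hy)
  have hyR : R₀ < ‖y‖ := by
    have := (le_max_right _ _).trans hy
    linarith
  have hfy : ContDiffAt ℝ ∞ f y := hR₀ y hyR
  have hpow : ∀ s : ℝ, 0 ≤ ‖y‖ ^ s := fun s => Real.rpow_nonneg (norm_nonneg _) _
  refine ⟨hfy, ?_, fun v hv => ?_⟩
  · have h := h₀ y hy0
    rw [norm_iteratedFDeriv_zero, Real.norm_eq_abs, Nat.cast_zero, sub_zero] at h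
    exact h.trans (mul_le_mul_of_nonneg_right (le_max_left _ _) (hpow _))
  · have h := h₁ y hy1
    have happ : |fderiv ℝ f y v| ≤ ‖iteratedFDeriv ℝ 1 f y‖ * ‖v‖ := by
      have := (iteratedFDeriv ℝ 1 f y).le_opNorm ![v]
      rw [iteratedFDeriv_one_apply] at this
      simpa [Real.norm_eq_abs] using this
    calc |fderiv ℝ f y v| ≤ ‖iteratedFDeriv ℝ 1 f y‖ * ‖v‖ := happ
      _ ≤ C₁ * ‖y‖ ^ (a - 1) * 1 := by
          rw [Nat.cast_one] at h
          exact mul_le_mul h hv (norm_nonneg _) (mul_nonneg hC₁ (hpow _))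
      _ ≤ max C₀ C₁ * ‖y‖ ^ (a - 1) := by
          rw [mul_one]
          exact mul_le_mul_of_nonneg_right (le_max_right _ _) (hpow _)

end SymbolOne

/-! ### Source bounds for a symbol of order one -/

/-- **Source bounds for `decay_bootstrap_six`**: if `g ∈ O_1(r⁻⁴)` then, along an orthonormal
basis `b` of `ℝ³`, for `|x|` large: `∫_{B̄(x,|x|/4)} g² ≤ K|x|⁻⁵`, `∫ (∂ₘg)² ≤ K|x|⁻⁷` and
`|∂ₘg| ≤ K|x|⁻⁵` on `B̄(x,|x|/4)`. [folklore] -/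
theorem exists_sourceBounds_one (b : OrthonormalBasis (Fin 3) ℝ E3) {g : E3 → ℝ}
    (hg : IsBigOSmooth 1 (-4) g) :
    ∃ K r₁ : ℝ, 0 ≤ K ∧ ∀ x : E3, r₁ ≤ ‖x‖ →
      (∫ y in closedBall x (1 / 4 * ‖x‖), g y ^ 2) ≤ K * ‖x‖ ^ (-5 : ℝ) ∧
      (∀ m, (∫ y in closedBall x (1 / 4 * ‖x‖), (fderiv ℝ g y (b m)) ^ 2) ≤ K * ‖x‖ ^ (-7 : ℝ)) ∧
      (∀ m, ∀ y ∈ closedBall x (1 / 4 * ‖x‖), |fderiv ℝ g y (b m)| ≤ K * ‖x‖ ^ (-5 : ℝ)) := by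
  have hb1 : ∀ i, ‖b i‖ ≤ 1 := fun i => (b.orthonormal.1 i).le
  obtain ⟨C, r₀, hC, h⟩ := exists_partial_bounds_of_isBigOSmooth_one hg
  refine ⟨6 * 64 * C ^ 2 + 8 * C, max (4 / 3 * r₀) 1, by positivity, fun x hx => ?_⟩
  have hx1 : 1 ≤ ‖x‖ := le_trans (le_max_right _ _) hx
  have hx0 : 0 < ‖x‖ := by linarith
  have hpow : ∀ s : ℝ, 0 ≤ ‖x‖ ^ s := fun s => Real.rpow_nonneg (norm_nonneg _) _
  have hquarter : (1 / 4 : ℝ) ≤ 1 / 4 := le_rfl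
  have hyfar : ∀ y ∈ closedBall x (1 / 4 * ‖x‖), r₀ ≤ ‖y‖ := fun y hy => by
    have h34 : 3 / 4 * ‖x‖ ≤ ‖y‖ := norm_ge_of_mem_closedBall hquarter hy
    have : 4 / 3 * r₀ ≤ ‖x‖ := le_trans (le_max_left _ _) hx
    linarith
  have hg0 : ∀ y : E3, r₀ ≤ ‖y‖ → |g y| ≤ C * ‖y‖ ^ (-(4 : ℝ)) := fun y hy => (h y hy).2.1
  have hg1 : ∀ m (y : E3), r₀ ≤ ‖y‖ → |fderiv ℝ g y (b m)| ≤ C * ‖y‖ ^ (-(5 : ℝ)) := by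
    intro m y hy
    have h' := (h y hy).2.2 (b m) (hb1 m)
    rwa [show (-4 : ℝ) - 1 = -(5 : ℝ) by norm_num] at h'
  have hKle : 6 * 64 * C ^ 2 ≤ 6 * 64 * C ^ 2 + 8 * C := by linarith
  refine ⟨?_, fun m => ?_, fun m y hy => ?_⟩
  · have h1 := setIntegral_quarterBall_sq_le hC (by norm_num) (by norm_num) hg0 hx
    rw [show (-(2 * 4) + 3 : ℝ) = -5 by norm_num] at h1
    exact h1.trans (mul_le_mul_of_nonneg_right hKle (hpow _))
  · have h1 := setIntegral_quarterBall_sq_le hC (by norm_num) (by norm_num) (hg1 m) hx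
    rw [show (-(2 * 5) + 3 : ℝ) = -7 by norm_num] at h1
    exact h1.trans (mul_le_mul_of_nonneg_right hKle (hpow _))
  · have hyp : ‖y‖ ^ (-(5 : ℝ)) ≤ (4 / 3) ^ (5 : ℝ) * ‖x‖ ^ (-(5 : ℝ)) :=
      rpow_neg_le_of_mem_closedBall hquarter hx0 (by norm_num) hy
    have h43 : (4 / 3 : ℝ) ^ (5 : ℝ) ≤ 8 := by norm_num
    calc |fderiv ℝ g y (b m)| ≤ C * ‖y‖ ^ (-(5 : ℝ)) := hg1 m y (hyfar y hy)
      _ ≤ C * ((4 / 3) ^ (5 : ℝ) * ‖x‖ ^ (-(5 : ℝ))) := mul_le_mul_of_nonneg_left hyp hC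
      _ ≤ C * (8 * ‖x‖ ^ (-(5 : ℝ))) := by
          refine mul_le_mul_of_nonneg_left (mul_le_mul_of_nonneg_right h43 (hpow _)) hC
      _ = 8 * C * ‖x‖ ^ (-5 : ℝ) := by ring_nf
      _ ≤ (6 * 64 * C ^ 2 + 8 * C) * ‖x‖ ^ (-5 : ℝ) :=
          mul_le_mul_of_nonneg_right (by nlinarith) (hpow _)

namespace AFEnd

variable {X : Type} [TopologicalSpace X] [ChartedSpace E3 X] [IsManifold (𝓡 3) ∞ X]
  (e : AFEnd X) (D : InitialDataSet (𝓡 3) X)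

set_option maxHeartbeats 800000 in
/-- **The coefficients of the chart equation on an `O₃(r⁻²)` end satisfy the hypotheses of
`decay_bootstrap_six`**: smoothness far out and, with one constant `K`, `Σ|a − δ| ≤ Kr⁻²`,
`Σ|β| ≤ Kr⁻³`, `|c| ≤ Kr⁻⁴` (`c = −R∘Φ/8`) and first partials `≤ Kr⁻³`; moreover
`|R∘Φ| ≤ K r⁻⁴` and `|∂(R∘Φ)| ≤ K r⁻⁵` (`R∘Φ ∈ O_1(r⁻⁴)`, `isBigOSmooth_scalarCurvatureCoeff`
with `k = 1`). [cite: SchoenYauPMT1979, §1 (1.1), §3 Lemma 3.3 and p. 73] -/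
theorem exists_bootstrapCoeff_three [D.metric.HasLeviCivita] (b : OrthonormalBasis (Fin 3) ℝ E3)
    (hH : IsBigOSmooth 3 (-2) fun y ↦ hCoeff e D y - (innerSL ℝ : E3 →L[ℝ] E3 →L[ℝ] ℝ)) :
    ∃ K r₁ : ℝ, 0 ≤ K ∧ 1 ≤ r₁ ∧ e.R < r₁ ∧
      (∀ k l, ContDiffOn ℝ ∞ (fun y ↦ MetricCoord.ginv (hCoeff e D) b.toBasis y l k)
        {y : E3 | r₁ < ‖y‖}) ∧
      (∀ m, ContDiffOn ℝ ∞ (fun y ↦ -(2⁻¹ * ∑ k, ∑ l, ∑ j,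
          MetricCoord.ginv (hCoeff e D) b.toBasis y k l * MetricCoord.ginv (hCoeff e D) b.toBasis y m j
            * MetricCoord.koszulCLM (hCoeff e D) y (b k) (b l) (b j))) {y : E3 | r₁ < ‖y‖}) ∧
      ContDiffOn ℝ ∞ (scalarCurvatureCoeff e D) {y : E3 | r₁ < ‖y‖} ∧
      ∀ y : E3, r₁ + 1 ≤ ‖y‖ →
      (∑ k, ∑ l, |MetricCoord.ginv (hCoeff e D) b.toBasis y l k - if k = l then 1 else 0|
          ≤ K * ‖y‖ ^ (-2 : ℝ)) ∧
      (∑ m, |-(2⁻¹ * ∑ k, ∑ l, ∑ j,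
          MetricCoord.ginv (hCoeff e D) b.toBasis y k l * MetricCoord.ginv (hCoeff e D) b.toBasis y m j
            * MetricCoord.koszulCLM (hCoeff e D) y (b k) (b l) (b j))| ≤ K * ‖y‖ ^ (-3 : ℝ)) ∧
      |-8⁻¹ * scalarCurvatureCoeff e D y| ≤ K * ‖y‖ ^ (-4 : ℝ) ∧
      (∀ i, (∀ k l, |fderiv ℝ (fun z ↦ MetricCoord.ginv (hCoeff e D) b.toBasis z l k) y (b i)|
            ≤ K * ‖y‖ ^ (-3 : ℝ)) ∧
        (∀ m, |fderiv ℝ (fun z ↦ -(2⁻¹ * ∑ k, ∑ l, ∑ j,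
          MetricCoord.ginv (hCoeff e D) b.toBasis z k l * MetricCoord.ginv (hCoeff e D) b.toBasis z m j
            * MetricCoord.koszulCLM (hCoeff e D) z (b k) (b l) (b j))) y (b i)| ≤ K * ‖y‖ ^ (-3 : ℝ)) ∧
        |fderiv ℝ (fun z ↦ -8⁻¹ * scalarCurvatureCoeff e D z) y (b i)| ≤ K * ‖y‖ ^ (-3 : ℝ)) ∧
      |scalarCurvatureCoeff e D y| ≤ K * ‖y‖ ^ (-4 : ℝ) ∧
      (∀ i, |fderiv ℝ (scalarCurvatureCoeff e D) y (b i)| ≤ K * ‖y‖ ^ (-5 : ℝ)) := by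
  have hb1 : ∀ i, ‖b i‖ ≤ 1 := fun i => (b.orthonormal.1 i).le
  have two : (0 : ℝ) < 2 := two_pos
  -- the three families of symbols
  have hA : ∀ p : Fin 3 × Fin 3, IsBigOSmooth 2 (-2) fun y ↦
      MetricCoord.ginv (hCoeff e D) b.toBasis y p.2 p.1 - if p.1 = p.2 then 1 else 0 := by
    intro p
    have h := (e.isBigOSmooth_ginv_sub D b (k := 2) (hH.of_le (show 2 ≤ 3 by norm_num)) two p.2 p.1)
    refine h.congr fun y ↦ ?_
    rcases eq_or_ne p.1 p.2 with h' | h'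
    · simp [h']
    · simp [h', h'.symm]
  have hB : ∀ m : Fin 3, IsBigOSmooth 2 (-2 - 1) fun y ↦ -(2⁻¹ * ∑ k, ∑ l, ∑ j,
      MetricCoord.ginv (hCoeff e D) b.toBasis y k l * MetricCoord.ginv (hCoeff e D) b.toBasis y m j
        * MetricCoord.koszulCLM (hCoeff e D) y (b k) (b l) (b j)) := fun m =>
    (e.isBigOSmooth_firstOrderCoeff D b (k := 2) hH two m)
  have hC : IsBigOSmooth 1 (-2 - 2) (scalarCurvatureCoeff e D) :=
    e.isBigOSmooth_scalarCurvatureCoeff D (k := 1) hH two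
  obtain ⟨C₁, s₁, hC₁, h₁⟩ := exists_uniform_partial_bounds_of_isBigOSmooth hA
  obtain ⟨C₂, s₂, hC₂, h₂⟩ := exists_uniform_partial_bounds_of_isBigOSmooth hB
  obtain ⟨C₃, s₃, hC₃, h₃⟩ := exists_partial_bounds_of_isBigOSmooth_one hC
  set K : ℝ := 9 * C₁ + 3 * C₂ + C₃ with hKdef
  set r₁ : ℝ := max (max s₁ s₂) (max s₃ (|e.R| + 1)) with hr₁
  have hK : 0 ≤ K := by positivity
  have hK₁ : C₁ ≤ K := by rw [hKdef]; linarith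
  have hK₂ : C₂ ≤ K := by rw [hKdef]; linarith
  have hK₃ : C₃ ≤ K := by rw [hKdef]; linarith
  have hr₁1 : 1 ≤ r₁ := by
    have : |e.R| + 1 ≤ r₁ := (le_max_right _ _).trans (le_max_right _ _)
    linarith [abs_nonneg e.R]
  have hRr₁ : e.R < r₁ := by
    have : |e.R| + 1 ≤ r₁ := (le_max_right _ _).trans (le_max_right _ _)
    linarith [le_abs_self e.R]
  have hfar : ∀ {y : E3}, r₁ ≤ ‖y‖ → s₁ ≤ ‖y‖ ∧ s₂ ≤ ‖y‖ ∧ s₃ ≤ ‖y‖ := fun hy =>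
    ⟨le_trans (le_max_left _ _) ((le_max_left _ _).trans hy),
      le_trans (le_max_right _ _) ((le_max_left _ _).trans hy),
      le_trans (le_max_left _ _) ((le_max_right _ _).trans hy)⟩
  have hU : IsOpen {y : E3 | r₁ < ‖y‖} := isOpen_lt continuous_const continuous_norm
  -- smoothness far out
  have hsA : ∀ k l, ContDiffOn ℝ ∞ (fun y ↦ MetricCoord.ginv (hCoeff e D) b.toBasis y l k)
      {y : E3 | r₁ < ‖y‖} := by
    intro k l y hy
    have h := (h₁ (k, l) y (hfar (le_of_lt hy)).1).1
    have h' : ContDiffAt ℝ ∞ (fun y ↦ MetricCoord.ginv (hCoeff e D) b.toBasis y l k) y := by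
      simpa using h.add (contDiffAt_const (c := if k = l then (1 : ℝ) else 0))
    exact h'.contDiffWithinAt
  have hsB : ∀ m, ContDiffOn ℝ ∞ (fun y ↦ -(2⁻¹ * ∑ k, ∑ l, ∑ j,
      MetricCoord.ginv (hCoeff e D) b.toBasis y k l * MetricCoord.ginv (hCoeff e D) b.toBasis y m j
        * MetricCoord.koszulCLM (hCoeff e D) y (b k) (b l) (b j))) {y : E3 | r₁ < ‖y‖} :=
    fun m y hy => ((h₂ m y (hfar (le_of_lt hy)).2.1).1).contDiffWithinAt
  have hsC : ContDiffOn ℝ ∞ (scalarCurvatureCoeff e D) {y : E3 | r₁ < ‖y‖} :=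
    fun y hy => ((h₃ y (hfar (le_of_lt hy)).2.2).1).contDiffWithinAt
  refine ⟨K, r₁, hK, hr₁1, hRr₁, hsA, hsB, hsC, fun y hy => ?_⟩
  have hy₁ : r₁ ≤ ‖y‖ := by linarith
  obtain ⟨hys₁, hys₂, hys₃⟩ := hfar hy₁
  have hyU : y ∈ {y : E3 | r₁ < ‖y‖} := by show r₁ < ‖y‖; linarith
  have hy1 : 1 ≤ ‖y‖ := hr₁1.trans hy₁
  have hpow : ∀ s : ℝ, 0 ≤ ‖y‖ ^ s := fun s => Real.rpow_nonneg (norm_nonneg _) _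
  have hmono : ∀ {s t : ℝ}, s ≤ t → ‖y‖ ^ s ≤ ‖y‖ ^ t := fun hst =>
    Real.rpow_le_rpow_of_exponent_le hy1 hst
  -- scalar curvature
  obtain ⟨-, hR0, hR1⟩ := h₃ y hys₃
  rw [show (-2 : ℝ) - 2 = -4 by norm_num] at hR0
  have hR1' : ∀ i, |fderiv ℝ (scalarCurvatureCoeff e D) y (b i)| ≤ K * ‖y‖ ^ (-5 : ℝ) := fun i => by
    have h := hR1 (b i) (hb1 i)
    rw [show (-2 : ℝ) - 2 - 1 = -5 by norm_num] at h
    exact h.trans (mul_le_mul_of_nonneg_right hK₃ (hpow _))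
  have hR0' : |scalarCurvatureCoeff e D y| ≤ K * ‖y‖ ^ (-4 : ℝ) :=
    hR0.trans (mul_le_mul_of_nonneg_right hK₃ (hpow _))
  obtain ⟨hc1, -⟩ := partials_const_mul hU hsC (-8⁻¹) hyU
  refine ⟨?_, ?_, ?_, fun i => ⟨fun k l => ?_, fun m => ?_, ?_⟩, hR0', hR1'⟩
  · -- `Σ |a - δ|`
    have h : ∀ k l, |MetricCoord.ginv (hCoeff e D) b.toBasis y l k - if k = l then 1 else 0|
        ≤ C₁ * ‖y‖ ^ (-2 : ℝ) := fun k l => (h₁ (k, l) y hys₁).2.1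
    calc ∑ k, ∑ l, |MetricCoord.ginv (hCoeff e D) b.toBasis y l k - if k = l then 1 else 0|
        ≤ ∑ k : Fin 3, ∑ l : Fin 3, C₁ * ‖y‖ ^ (-2 : ℝ) :=
          Finset.sum_le_sum fun k _ => Finset.sum_le_sum fun l _ => h k l
      _ = 9 * C₁ * ‖y‖ ^ (-2 : ℝ) := by simp; ring
      _ ≤ K * ‖y‖ ^ (-2 : ℝ) := by
          apply mul_le_mul_of_nonneg_right _ (hpow _); rw [hKdef]; linarith
  · -- `Σ |β|`
    calc ∑ m, |-(2⁻¹ * ∑ k, ∑ l, ∑ j,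
          MetricCoord.ginv (hCoeff e D) b.toBasis y k l * MetricCoord.ginv (hCoeff e D) b.toBasis y m j
            * MetricCoord.koszulCLM (hCoeff e D) y (b k) (b l) (b j))|
        ≤ ∑ m : Fin 3, C₂ * ‖y‖ ^ (-3 : ℝ) := Finset.sum_le_sum fun m _ => by
          have := (h₂ m y hys₂).2.1; rwa [show (-2 : ℝ) - 1 = -3 by norm_num] at this
      _ = 3 * C₂ * ‖y‖ ^ (-3 : ℝ) := by simp; ring
      _ ≤ K * ‖y‖ ^ (-3 : ℝ) := by
          apply mul_le_mul_of_nonneg_right _ (hpow _); rw [hKdef]; linarith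
  · -- `|c|`
    rw [abs_mul, show |(-8⁻¹ : ℝ)| = 8⁻¹ by norm_num]
    nlinarith [hR0', hpow (-4), hK]
  · -- `∂a`
    have h := (h₁ (k, l) y hys₁).2.2.1 (b i) (hb1 i)
    have e1 : fderiv ℝ (fun z ↦ MetricCoord.ginv (hCoeff e D) b.toBasis z l k) y =
        fderiv ℝ (fun z ↦ MetricCoord.ginv (hCoeff e D) b.toBasis z l k - if k = l then 1 else 0) y := by
      rw [fderiv_sub_const]
    rw [e1]
    rw [show (-2 : ℝ) - 1 = -3 by norm_num] at h
    exact h.trans (mul_le_mul_of_nonneg_right hK₁ (hpow _))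
  · -- `∂β`
    have h := (h₂ m y hys₂).2.2.1 (b i) (hb1 i)
    rw [show (-2 : ℝ) - 1 - 1 = -4 by norm_num] at h
    exact h.trans ((mul_le_mul_of_nonneg_right hK₂ (hpow _)).trans
      (mul_le_mul_of_nonneg_left (hmono (by norm_num)) hK))
  · -- `∂c`
    rw [hc1, abs_mul, show |(-8⁻¹ : ℝ)| = 8⁻¹ by norm_num]
    have h5 := (hR1' i).trans (mul_le_mul_of_nonneg_left (hmono (show (-5:ℝ) ≤ -3 by norm_num)) hK)
    nlinarith [hpow (-3), hK, abs_nonneg (fderiv ℝ (scalarCurvatureCoeff e D) y (b i))]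

end AFEnd

namespace AFEnd

variable {X : Type} [TopologicalSpace X] [ChartedSpace E3 X] [IsManifold (𝓡 3) ∞ X]
  (e : AFEnd X) (D : InitialDataSet (𝓡 3) X)


set_option maxHeartbeats 800000 in
/-- **One run of the decay bootstrap for the chart equation, `O₃(r⁻²)` end, source in `O_1(r⁻⁴)`.** If `u` is smooth far out and
solves `Σ a_{kl}∂ₗ∂ₖu + Σ βₘ∂ₘu − (R∘Φ/8) u = g` there (the coefficients of `Δ_h` on an `O₃(r⁻²)`
end), with `g ∈ O_1(r⁻⁴)` and `∫_{B̄(x,|x|/4)} u² ≤ K₀|x|^q` (`q ≥ −1`), then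
`|u| ≤ C r^{(q−3)/2}`, `|∂u| ≤ C r^{(q−5)/2}`, `|∂²u| ≤ C r^{(q−7)/2}` far out
(`Literature.Analysis.PDE.decay_bootstrap_six` with `θ = 1/4`). Schoen–Yau obtain these pointwise
derivative estimates from (3.9) by Schauder theory ("standard interior estimates", p. 67).
[cite: SchoenYauPMT1979, Lemma 3.2, (3.9)–(3.11) (p. 67)] -/
theorem bootstrap_stage_three [D.metric.HasLeviCivita] (b : OrthonormalBasis (Fin 3) ℝ E3)
    (hH : IsBigOSmooth 3 (-2) fun y ↦ hCoeff e D y - (innerSL ℝ : E3 →L[ℝ] E3 →L[ℝ] ℝ))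
    {u g : E3 → ℝ} {q ρ : ℝ} (hq : -1 ≤ q)
    (hu : ContDiffOn ℝ ∞ u {y : E3 | ρ < ‖y‖}) (hg : IsBigOSmooth 1 (-4) g)
    (heq : ∀ y : E3, ρ < ‖y‖ →
      ∑ k, ∑ l, MetricCoord.ginv (hCoeff e D) b.toBasis y l k
          * fderiv ℝ (fun z' => fderiv ℝ u z' (b k)) y (b l)
        + ∑ m, (-(2⁻¹ * ∑ k, ∑ l, ∑ j, MetricCoord.ginv (hCoeff e D) b.toBasis y k l
            * MetricCoord.ginv (hCoeff e D) b.toBasis y m j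
            * MetricCoord.koszulCLM (hCoeff e D) y (b k) (b l) (b j))) * fderiv ℝ u y (b m)
        + (-8⁻¹ * scalarCurvatureCoeff e D y) * u y = g y)
    {K₀ r₀ : ℝ} (hK₀ : 0 ≤ K₀)
    (hI : ∀ x : E3, r₀ ≤ ‖x‖ → ∫ y in closedBall x (1 / 4 * ‖x‖), u y ^ 2 ≤ K₀ * ‖x‖ ^ q) :
    ∃ C r₂ : ℝ, 0 ≤ C ∧ ∀ x : E3, r₂ ≤ ‖x‖ →
      |u x| ≤ C * ‖x‖ ^ ((q - 3) / 2) ∧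
      (∀ m, |fderiv ℝ u x (b m)| ≤ C * ‖x‖ ^ ((q - 5) / 2)) ∧
      (∀ m n, |fderiv ℝ (fun z => fderiv ℝ u z (b m)) x (b n)| ≤ C * ‖x‖ ^ ((q - 7) / 2)) := by
  obtain ⟨K₁, r₁, hK₁, hr₁1, hRr₁, has, hβs, hRs, hcoef⟩ := e.exists_bootstrapCoeff_three D b hH
  obtain ⟨K₂, r₂, hK₂, hG⟩ := exists_sourceBounds_one b hg
  obtain ⟨Rg, hgs⟩ := hg.1
  -- the common far region
  set R₀ : ℝ := max (max ρ r₁) Rg with hR₀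
  have hρR : ρ ≤ R₀ := (le_max_left _ _).trans (le_max_left _ _)
  have hr₁R : r₁ ≤ R₀ := (le_max_right _ _).trans (le_max_left _ _)
  have hRgR : Rg ≤ R₀ := le_max_right _ _
  have hsub : ∀ {t : ℝ}, t ≤ R₀ → {y : E3 | R₀ < ‖y‖} ⊆ {y : E3 | t < ‖y‖} := fun ht y hy =>
    lt_of_le_of_lt ht hy
  have hu' : ContDiffOn ℝ ∞ u {y : E3 | R₀ < ‖y‖} := hu.mono (hsub hρR)
  have hg' : ContDiffOn ℝ ∞ g {y : E3 | R₀ < ‖y‖} := hgs.mono (hsub hRgR)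
  have has' : ∀ k l, ContDiffOn ℝ ∞ (fun y ↦ MetricCoord.ginv (hCoeff e D) b.toBasis y l k)
      {y : E3 | R₀ < ‖y‖} := fun k l => (has k l).mono (hsub hr₁R)
  have hβs' : ∀ m, ContDiffOn ℝ ∞ (fun y ↦ -(2⁻¹ * ∑ k, ∑ l, ∑ j,
      MetricCoord.ginv (hCoeff e D) b.toBasis y k l * MetricCoord.ginv (hCoeff e D) b.toBasis y m j
        * MetricCoord.koszulCLM (hCoeff e D) y (b k) (b l) (b j))) {y : E3 | R₀ < ‖y‖} :=
    fun m => (hβs m).mono (hsub hr₁R)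
  have hcs' : ContDiffOn ℝ ∞ (fun y ↦ -8⁻¹ * scalarCurvatureCoeff e D y) {y : E3 | R₀ < ‖y‖} :=
    contDiffOn_const.mul (hRs.mono (hsub hr₁R))
  have heq' : ∀ z ∈ {y : E3 | R₀ < ‖y‖},
      ∑ k, ∑ l, MetricCoord.ginv (hCoeff e D) b.toBasis z l k
          * fderiv ℝ (fun z' => fderiv ℝ u z' (b k)) z (b l)
        + ∑ m, (-(2⁻¹ * ∑ k, ∑ l, ∑ j, MetricCoord.ginv (hCoeff e D) b.toBasis z k l
            * MetricCoord.ginv (hCoeff e D) b.toBasis z m j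
            * MetricCoord.koszulCLM (hCoeff e D) z (b k) (b l) (b j))) * fderiv ℝ u z (b m)
        + (-8⁻¹ * scalarCurvatureCoeff e D z) * u z = g z := fun z hz => heq z (lt_of_le_of_lt hρR hz)
  -- one constant and one radius
  set K : ℝ := max K₁ K₂ with hKdef
  have hK : 0 ≤ K := hK₁.trans (le_max_left _ _)
  set r' : ℝ := max (r₁ + 1) (max r₂ r₀) with hr'
  have hpow : ∀ (y : E3) (s : ℝ), 0 ≤ ‖y‖ ^ s := fun y s => Real.rpow_nonneg (norm_nonneg _) _
  have hle₁ : ∀ {t : ℝ} {y : E3} {s : ℝ}, t ≤ K₁ * ‖y‖ ^ s → t ≤ K * ‖y‖ ^ s := fun h =>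
    h.trans (mul_le_mul_of_nonneg_right (le_max_left _ _) (hpow _ _))
  have hle₂ : ∀ {t : ℝ} {y : E3} {s : ℝ}, t ≤ K₂ * ‖y‖ ^ s → t ≤ K * ‖y‖ ^ s := fun h =>
    h.trans (mul_le_mul_of_nonneg_right (le_max_right _ _) (hpow _ _))
  have hcoef' : ∀ y : E3, r' ≤ ‖y‖ →
      (∑ k, ∑ l, |MetricCoord.ginv (hCoeff e D) b.toBasis y l k - if k = l then 1 else 0|
          ≤ K * ‖y‖ ^ (-2 : ℝ)) ∧
      (∑ m, |-(2⁻¹ * ∑ k, ∑ l, ∑ j,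
          MetricCoord.ginv (hCoeff e D) b.toBasis y k l * MetricCoord.ginv (hCoeff e D) b.toBasis y m j
            * MetricCoord.koszulCLM (hCoeff e D) y (b k) (b l) (b j))| ≤ K * ‖y‖ ^ (-3 : ℝ)) ∧
      |-8⁻¹ * scalarCurvatureCoeff e D y| ≤ K * ‖y‖ ^ (-4 : ℝ) ∧
      (∀ i, (∀ k l, |fderiv ℝ (fun z ↦ MetricCoord.ginv (hCoeff e D) b.toBasis z l k) y (b i)|
            ≤ K * ‖y‖ ^ (-3 : ℝ)) ∧
        (∀ m, |fderiv ℝ (fun z ↦ -(2⁻¹ * ∑ k, ∑ l, ∑ j,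
          MetricCoord.ginv (hCoeff e D) b.toBasis z k l * MetricCoord.ginv (hCoeff e D) b.toBasis z m j
            * MetricCoord.koszulCLM (hCoeff e D) z (b k) (b l) (b j))) y (b i)| ≤ K * ‖y‖ ^ (-3 : ℝ)) ∧
        |fderiv ℝ (fun z ↦ -8⁻¹ * scalarCurvatureCoeff e D z) y (b i)| ≤ K * ‖y‖ ^ (-3 : ℝ)) := by
    intro y hy
    have hy' : r₁ + 1 ≤ ‖y‖ := (le_max_left _ _).trans hy
    obtain ⟨h1, h2, h3, h4, -, -⟩ := hcoef y hy'
    refine ⟨hle₁ h1, hle₁ h2, hle₁ h3, fun i => ?_⟩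
    obtain ⟨h4a, h4b, h4c⟩ := h4 i
    exact ⟨fun k l => hle₁ (h4a k l), fun m => hle₁ (h4b m), hle₁ h4c⟩
  have hG' : ∀ x : E3, r' ≤ ‖x‖ →
      (∫ y in closedBall x (1 / 4 * ‖x‖), g y ^ 2) ≤ K * ‖x‖ ^ (-5 : ℝ) ∧
      (∀ m, (∫ y in closedBall x (1 / 4 * ‖x‖), (fderiv ℝ g y (b m)) ^ 2) ≤ K * ‖x‖ ^ (-7 : ℝ)) ∧
      (∀ m, ∀ y ∈ closedBall x (1 / 4 * ‖x‖), |fderiv ℝ g y (b m)| ≤ K * ‖x‖ ^ (-5 : ℝ)) := by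
    intro x hx
    have hx' : r₂ ≤ ‖x‖ := le_trans (le_trans (le_max_left _ _) (le_max_right _ _)) hx
    obtain ⟨h1, h2, h3⟩ := hG x hx'
    exact ⟨hle₂ h1, fun m => hle₂ (h2 m), fun m y hy => hle₂ (h3 m y hy)⟩
  have hI' : ∀ x : E3, r' ≤ ‖x‖ → ∫ y in closedBall x (1 / 4 * ‖x‖), u y ^ 2 ≤ K₀ * ‖x‖ ^ q :=
    fun x hx => hI x (le_trans (le_trans (le_max_right _ _) (le_max_right _ _)) hx)
  -- the bootstrap
  obtain ⟨C, r₃, hC⟩ := decay_bootstrap_six b (R₀ := R₀) (θ := 1 / 4) (by norm_num) le_rfl hq hK hK₀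
    hu' hg' has' hβs' hcs' heq' hcoef' hG' hI'
  refine ⟨Real.sqrt C, max r₃ 1, Real.sqrt_nonneg _, fun x hx => ?_⟩
  have hx₃ : r₃ ≤ ‖x‖ := (le_max_left _ _).trans hx
  have hx0 : 0 < ‖x‖ := lt_of_lt_of_le one_pos ((le_max_right _ _).trans hx)
  obtain ⟨h0, h1, h2⟩ := hC x hx₃
  refine ⟨?_, fun m => ?_, fun m n => ?_⟩
  · have := abs_le_sqrt_mul_rpow_half hx0 h0
    rwa [show (q - 3) / 2 = (q - 3) / 2 from rfl] at this
  · exact abs_le_sqrt_mul_rpow_half hx0 (h1 m)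
  · exact abs_le_sqrt_mul_rpow_half hx0 (h2 m n)


/-- **The monopole error of the chart equation is `O_1(r⁻⁵)` on an `O₃(r⁻²)` end**:
`E = Σ (aₖₗ − δₖₗ) ∂ₗ∂ₖ(1/r) + Σ βₘ ∂ₘ(1/r) − (R∘Φ/8)/r` with `a − δ ∈ O(r⁻²)`, `β ∈ O(r⁻³)`,
`R∘Φ ∈ O(r⁻⁴)` and `∂ᵏ(1/r) ∈ O(r^{−1−k})`. Hence the source of the equation for `u − A/r`,
`R∘Φ/8 − A E`, is again `O_1(r⁻⁴)`. [cite: SchoenYauPMT1979, Lemma 3.2, (3.19)–(3.20)] -/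
theorem isBigOSmooth_monopoleError_three [D.metric.HasLeviCivita] (b : OrthonormalBasis (Fin 3) ℝ E3)
    (hH : IsBigOSmooth 3 (-2) fun y ↦ hCoeff e D y - (innerSL ℝ : E3 →L[ℝ] E3 →L[ℝ] ℝ)) :
    IsBigOSmooth 1 (-5) fun y ↦
      ∑ k, ∑ l, (MetricCoord.ginv (hCoeff e D) b.toBasis y l k - if k = l then 1 else 0)
          * fderiv ℝ (fun z => fderiv ℝ (fun z' : E3 => ‖z'‖⁻¹) z (b k)) y (b l)
        + ∑ m, (-(2⁻¹ * ∑ k, ∑ l, ∑ j, MetricCoord.ginv (hCoeff e D) b.toBasis y k l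
            * MetricCoord.ginv (hCoeff e D) b.toBasis y m j
            * MetricCoord.koszulCLM (hCoeff e D) y (b k) (b l) (b j)))
          * fderiv ℝ (fun z' : E3 => ‖z'‖⁻¹) y (b m)
        + (-8⁻¹ * scalarCurvatureCoeff e D y) * ‖y‖⁻¹ := by
  have two : (0 : ℝ) < 2 := two_pos
  -- the factors
  have hA : ∀ k l : Fin 3, IsBigOSmooth 1 (-2) fun y ↦
      MetricCoord.ginv (hCoeff e D) b.toBasis y l k - if k = l then 1 else 0 := by
    intro k l
    have h := e.isBigOSmooth_ginv_sub D b (k := 1) (hH.of_le (show 1 ≤ 3 by norm_num)) two l k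
    refine h.congr fun y ↦ ?_
    rcases eq_or_ne k l with h' | h'
    · simp [h']
    · simp [h', h'.symm]
  have hψ3 : IsBigOSmooth 3 (-1) fun y : E3 ↦ ‖y‖⁻¹ := isBigOSmooth_inv_norm_all 3
  have hψ2 : IsBigOSmooth 2 (-1) fun y : E3 ↦ ‖y‖⁻¹ := isBigOSmooth_inv_norm_all 2
  have hψ1 : IsBigOSmooth 1 (-1) fun y : E3 ↦ ‖y‖⁻¹ := isBigOSmooth_inv_norm_all 1
  have hdψ : ∀ m : Fin 3, IsBigOSmooth 1 (-2) fun y ↦ fderiv ℝ (fun z' : E3 => ‖z'‖⁻¹) y (b m) := by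
    intro m
    have h := hψ2.fderiv_apply_const (k := 1) (b m)
    rwa [show (-1 : ℝ) - 1 = -2 by norm_num] at h
  have hddψ : ∀ k l : Fin 3, IsBigOSmooth 1 (-3) fun y ↦
      fderiv ℝ (fun z => fderiv ℝ (fun z' : E3 => ‖z'‖⁻¹) z (b k)) y (b l) := by
    intro k l
    have h := (hψ3.fderiv_apply_const (k := 2) (b k)).fderiv_apply_const (k := 1) (b l)
    rwa [show (-1 : ℝ) - 1 - 1 = -3 by norm_num] at h
  have hB : ∀ m : Fin 3, IsBigOSmooth 1 (-2 - 1) fun y ↦ -(2⁻¹ * ∑ k, ∑ l, ∑ j,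
      MetricCoord.ginv (hCoeff e D) b.toBasis y k l * MetricCoord.ginv (hCoeff e D) b.toBasis y m j
        * MetricCoord.koszulCLM (hCoeff e D) y (b k) (b l) (b j)) := fun m =>
    e.isBigOSmooth_firstOrderCoeff D b (k := 1) (hH.of_le (show 2 ≤ 3 by norm_num)) two m
  have hC : IsBigOSmooth 1 (-2 - 2) (scalarCurvatureCoeff e D) :=
    e.isBigOSmooth_scalarCurvatureCoeff D (k := 1) hH two
  -- the three terms
  have h1 : IsBigOSmooth 1 (-5) fun y ↦
      ∑ k, ∑ l, (MetricCoord.ginv (hCoeff e D) b.toBasis y l k - if k = l then 1 else 0)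
        * fderiv ℝ (fun z => fderiv ℝ (fun z' : E3 => ‖z'‖⁻¹) z (b k)) y (b l) := by
    have h := IsBigOSmooth.finset_sum (Finset.univ : Finset (Fin 3)) fun k _ ↦
      IsBigOSmooth.finset_sum (Finset.univ : Finset (Fin 3)) fun l _ ↦ (hA k l).mul (hddψ k l)
    rwa [show (-2 : ℝ) + -3 = -5 by norm_num] at h
  have h2 : IsBigOSmooth 1 (-5) fun y ↦ ∑ m, (-(2⁻¹ * ∑ k, ∑ l, ∑ j,
      MetricCoord.ginv (hCoeff e D) b.toBasis y k l * MetricCoord.ginv (hCoeff e D) b.toBasis y m j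
        * MetricCoord.koszulCLM (hCoeff e D) y (b k) (b l) (b j)))
        * fderiv ℝ (fun z' : E3 => ‖z'‖⁻¹) y (b m) := by
    have h := IsBigOSmooth.finset_sum (Finset.univ : Finset (Fin 3)) fun m _ ↦ (hB m).mul (hdψ m)
    rwa [show (-2 : ℝ) - 1 + -2 = -5 by norm_num] at h
  have h3 : IsBigOSmooth 1 (-5) fun y ↦ (-8⁻¹ * scalarCurvatureCoeff e D y) * ‖y‖⁻¹ := by
    have h := (hC.const_mul (-8⁻¹)).mul hψ1
    rwa [show (-2 : ℝ) - 2 + -1 = -5 by norm_num] at h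
  exact (h1.add h2).add h3


end AFEnd

/-! ### The expansion on an `O₃(r⁻²)` end -/

set_option maxHeartbeats 1600000 in
/-- **Schoen–Yau 1979, Lemma 3.2 (asymptotic half) on an `O₃(r⁻²)` end.** On initial data whose
end satisfies `h − δ ∈ O₃(r⁻²)` in the chart (in particular for the metrics `ds² + t Ric` of the
proof of Thm. 2, p. 73), every smooth solution `v ∈ L⁶(dV_h)` of `Δ_h v − (R/8) v = R/8` has an
expansion `v̂ = A/r + O₂(r⁻²)` (`‖∂^m(v̂ − A/r)‖ = O(r^{−2−m})`, `m ≤ 2`) for some constant `A`.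
The proof is that of `endValue_expansion_of_conformal_solution` with the `L⁶` top level of the
decay bootstrap (`bootstrap_stage_three`), the `O_1` source bounds and the `O_1(r⁻⁵)` monopole
error; the moment bound of `exists_monopole_of_laplacian` only uses `h − δ = O₂(r⁻²)`.
[cite: SchoenYauPMT1979, Lemma 3.2, (3.6)–(3.20) (pp. 66–70); proof of Thm. 2 (p. 73)] -/
theorem endValue_expansion_of_solution_three (X : Type) [TopologicalSpace X]
    [ChartedSpace E3 X] [IsManifold (𝓡 3) ∞ X] [T2Space X] [LocallyCompactSpace X]
    [MeasurableSpace X] [BorelSpace X]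
    (D : InitialDataSet (𝓡 3) X) [D.metric.HasLeviCivita] (e : AFEnd X)
    (hH3 : IsBigOSmooth 3 (-2) fun y ↦ e.hCoeff D y - (innerSL ℝ : E3 →L[ℝ] E3 →L[ℝ] ℝ))
    (hAF : e.IsMetricAsymptoticallyFlat D 2)
    (v : X → ℝ) (hv : ContMDiff (𝓡 3) 𝓘(ℝ) ∞ v) (hv6 : MemLp v 6 (riemannianMeasure D.h))
    (hpde : ∀ x, D.metric.dalembertian v x - D.metric.scalarCurvature x / 8 * v x =
      D.metric.scalarCurvature x / 8) :
    ∃ A : ℝ, ∀ m : ℕ, m ≤ 2 →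
      (fun x ↦ ‖iteratedFDeriv ℝ m (fun y ↦ endValue e v y - A / ‖y‖) x‖)
        =O[cobounded E3] fun x ↦ ‖x‖ ^ (-2 - m : ℝ) := by
  classical
  set b : OrthonormalBasis (Fin 3) ℝ E3 := EuclideanSpace.basisFun (Fin 3) ℝ with hb
  -- the chart representative, its smoothness and its equation
  have hρ0 : 0 ≤ e.R := e.R_pos.le
  have hU : IsOpen {y : E3 | e.R < ‖y‖} := isOpen_lt continuous_const continuous_norm
  have hu : ContDiffOn ℝ ∞ (endValue e v) {y : E3 | e.R < ‖y‖} := fun y hy =>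
    (e.contDiffAt_endValue_of_contMDiffAt hy hv.contMDiffAt).contDiffWithinAt
  have heq : ∀ y : E3, e.R < ‖y‖ →
      ∑ k, ∑ l, MetricCoord.ginv (e.hCoeff D) b.toBasis y l k
          * fderiv ℝ (fun z' => fderiv ℝ (endValue e v) z' (b k)) y (b l)
        + ∑ m, (-(2⁻¹ * ∑ k, ∑ l, ∑ j, MetricCoord.ginv (e.hCoeff D) b.toBasis y k l
            * MetricCoord.ginv (e.hCoeff D) b.toBasis y m j
            * MetricCoord.koszulCLM (e.hCoeff D) y (b k) (b l) (b j))) * fderiv ℝ (endValue e v) y (b m)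
        + (-8⁻¹ * e.scalarCurvatureCoeff D y) * endValue e v y = 8⁻¹ * e.scalarCurvatureCoeff D y :=
    fun y hy => e.chartEquation D b hv hpde hy
  have hg : IsBigOSmooth 1 (-4) fun y ↦ 8⁻¹ * e.scalarCurvatureCoeff D y := by
    have h := (e.isBigOSmooth_scalarCurvatureCoeff D (k := 1) hH3 two_pos).const_mul 8⁻¹
    rwa [show (-2 : ℝ) - 2 = -4 by norm_num] at h
  obtain ⟨K, rK, hK, hrK1, hRrK, -, -, -, hcoef⟩ := e.exists_bootstrapCoeff_three D b hH3
  have hpow0 : ∀ (y : E3) (s : ℝ), 0 ≤ ‖y‖ ^ s := fun y s => Real.rpow_nonneg (norm_nonneg _) _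
  /- ── Stage 1: `L⁶` ⟹ `v̂ = O(r^{-1/2})` with two derivatives ── -/
  obtain ⟨K₀, r₀, hK₀, hI₁⟩ := e.exists_ball_sq_integral_le_of_memLp D two_pos hAF hv.continuous hv6
  obtain ⟨C₁, r₁, hC₁, h₁⟩ := e.bootstrap_stage_three D b hH3 (q := 2) (by norm_num) hu hg heq hK₀ hI₁
  -- the flat Laplacian of `v̂`
  have hΔsrc : ∀ {C s r : ℝ} {y : E3}, 0 ≤ C → max (max r (rK + 1)) 1 ≤ ‖y‖ →
      (∀ y : E3, r ≤ ‖y‖ → |endValue e v y| ≤ C * ‖y‖ ^ s ∧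
        (∀ m, |fderiv ℝ (endValue e v) y (b m)| ≤ C * ‖y‖ ^ (s - 1)) ∧
        (∀ m n, |fderiv ℝ (fun z => fderiv ℝ (endValue e v) z (b m)) y (b n)| ≤ C * ‖y‖ ^ (s - 2))) →
      |(Δ (endValue e v)) y - 8⁻¹ * e.scalarCurvatureCoeff D y| ≤ 3 * K * C * ‖y‖ ^ (s - 4) ∧
      |e.scalarCurvatureCoeff D y| ≤ 8 * K * ‖y‖ ^ (-4 : ℝ) := by
    intro C s r y hC hy hbd
    have hyr : r ≤ ‖y‖ := le_trans (le_trans (le_max_left _ _) (le_max_left _ _)) hy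
    have hyK : rK + 1 ≤ ‖y‖ := le_trans (le_trans (le_max_right _ _) (le_max_left _ _)) hy
    have hy1 : 1 ≤ ‖y‖ := le_trans (le_max_right _ _) hy
    have hy0 : 0 < ‖y‖ := by linarith
    have hyR : e.R < ‖y‖ := by linarith
    obtain ⟨ha, hβ, hc, -, -, -⟩ := hcoef y hyK
    obtain ⟨h0, h1', h2'⟩ := hbd y hyr
    have hu2 : ContDiffAt ℝ 2 (endValue e v) y :=
      ((hu.contDiffAt (hU.mem_nhds hyR)).of_le (by norm_cast))
    refine ⟨abs_laplacian_sub_source_le b (u := endValue e v)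
      (g := fun y => 8⁻¹ * e.scalarCurvatureCoeff D y)
      (a := fun k l y => MetricCoord.ginv (e.hCoeff D) b.toBasis y l k)
      (β := fun m y => -(2⁻¹ * ∑ k, ∑ l, ∑ j, MetricCoord.ginv (e.hCoeff D) b.toBasis y k l
            * MetricCoord.ginv (e.hCoeff D) b.toBasis y m j
            * MetricCoord.koszulCLM (e.hCoeff D) y (b k) (b l) (b j)))
      (c := fun y => -8⁻¹ * e.scalarCurvatureCoeff D y)
      hC hy0 hu2 (heq y hyR) ha hβ hc h0 h1' h2', ?_⟩
    rw [abs_mul, show |(-8⁻¹ : ℝ)| = 8⁻¹ by norm_num] at hc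
    linarith
  have h₁' : ∀ y : E3, r₁ ≤ ‖y‖ → |endValue e v y| ≤ C₁ * ‖y‖ ^ (-(1 / 2) : ℝ) ∧
      (∀ m, |fderiv ℝ (endValue e v) y (b m)| ≤ C₁ * ‖y‖ ^ (-(1 / 2) - 1 : ℝ)) ∧
      (∀ m n, |fderiv ℝ (fun z => fderiv ℝ (endValue e v) z (b m)) y (b n)|
        ≤ C₁ * ‖y‖ ^ (-(1 / 2) - 2 : ℝ)) := by
    intro y hy
    obtain ⟨h0, h1', h2'⟩ := h₁ y hy
    refine ⟨by rwa [show ((2 : ℝ) - 3) / 2 = -(1 / 2) by norm_num] at h0, fun m => ?_, fun m n => ?_⟩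
    · have := h1' m; rwa [show ((2 : ℝ) - 5) / 2 = -(1 / 2) - 1 by norm_num] at this
    · have := h2' m n; rwa [show ((2 : ℝ) - 7) / 2 = -(1 / 2) - 2 by norm_num] at this
  set RA : ℝ := max (max r₁ (rK + 1)) 1 with hRA
  have hΔ₁ : ∀ y : E3, RA ≤ ‖y‖ → |(Δ (endValue e v)) y| ≤ (K + 3 * K * C₁) * ‖y‖ ^ (-4 : ℝ) := by
    intro y hy
    have hy1 : 1 ≤ ‖y‖ := le_trans (le_max_right _ _) hy
    obtain ⟨hlap, hR⟩ := hΔsrc hC₁ hy h₁'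
    have hmono : ‖y‖ ^ (-(1 / 2) - 4 : ℝ) ≤ ‖y‖ ^ (-4 : ℝ) :=
      Real.rpow_le_rpow_of_exponent_le hy1 (by norm_num)
    calc |(Δ (endValue e v)) y|
        = |((Δ (endValue e v)) y - 8⁻¹ * e.scalarCurvatureCoeff D y) + 8⁻¹ * e.scalarCurvatureCoeff D y| := by
          ring_nf
      _ ≤ |(Δ (endValue e v)) y - 8⁻¹ * e.scalarCurvatureCoeff D y| + |8⁻¹ * e.scalarCurvatureCoeff D y| :=
          abs_add_le _ _
      _ ≤ 3 * K * C₁ * ‖y‖ ^ (-(1 / 2) - 4 : ℝ) + 8⁻¹ * (8 * K * ‖y‖ ^ (-4 : ℝ)) := by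
          rw [abs_mul, abs_of_pos (by norm_num : (0 : ℝ) < 8⁻¹)]
          exact add_le_add hlap (mul_le_mul_of_nonneg_left hR (by norm_num))
      _ ≤ (K + 3 * K * C₁) * ‖y‖ ^ (-4 : ℝ) := by
          have := mul_le_mul_of_nonneg_left hmono (by positivity : (0 : ℝ) ≤ 3 * K * C₁)
          nlinarith [hpow0 y (-4)]
  have hdec₁ : ∀ y : E3, RA ≤ ‖y‖ → |endValue e v y| ≤ C₁ * ‖y‖ ^ (-(1 / 2) : ℝ) := fun y hy =>
    (h₁' y (le_trans (le_trans (le_max_left _ _) (le_max_left _ _)) hy)).1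
  /- ── Green's representation: `v̂ = O(1/r)` ── -/
  obtain ⟨C₂, R₂, h₂⟩ := exists_inv_norm_bound_of_laplacian_decay hρ0 (s := 1 / 2) (by norm_num)
    hu hdec₁ hΔ₁
  set C₂' : ℝ := max C₂ 0 with hC₂'
  have h₂' : ∀ y : E3, R₂ ≤ ‖y‖ → |endValue e v y| ≤ C₂' * ‖y‖ ^ (-(1 : ℝ)) := fun y hy => by
    rw [Real.rpow_neg_one]
    exact (h₂ y hy).trans (mul_le_mul_of_nonneg_right (le_max_left _ _) (inv_nonneg.2 (norm_nonneg _)))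
  /- ── Stage 2: `∂ᵏ v̂ = O(r^{-1-k})` ── -/
  have hI₂ : ∀ x : E3, max (4 / 3 * R₂) 1 ≤ ‖x‖ →
      ∫ y in closedBall x (1 / 4 * ‖x‖), endValue e v y ^ 2 ≤ 6 * 64 * C₂' ^ 2 * ‖x‖ ^ (1 : ℝ) := by
    intro x hx
    have h := setIntegral_quarterBall_sq_le (le_max_right _ _) zero_le_one (by norm_num) h₂' hx
    rwa [show (-(2 * 1) + 3 : ℝ) = 1 by norm_num] at h
  obtain ⟨C₃, r₃, hC₃, h₃⟩ := e.bootstrap_stage_three D b hH3 (q := 1) (by norm_num) hu hg heq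
    (by positivity) hI₂
  have h₃' : ∀ y : E3, r₃ ≤ ‖y‖ → |endValue e v y| ≤ C₃ * ‖y‖ ^ (-1 : ℝ) ∧
      (∀ m, |fderiv ℝ (endValue e v) y (b m)| ≤ C₃ * ‖y‖ ^ (-1 - 1 : ℝ)) ∧
      (∀ m n, |fderiv ℝ (fun z => fderiv ℝ (endValue e v) z (b m)) y (b n)|
        ≤ C₃ * ‖y‖ ^ (-1 - 2 : ℝ)) := by
    intro y hy
    obtain ⟨h0, h1', h2'⟩ := h₃ y hy
    refine ⟨by rwa [show ((1 : ℝ) - 3) / 2 = -1 by norm_num] at h0, fun m => ?_, fun m n => ?_⟩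
    · have := h1' m; rwa [show ((1 : ℝ) - 5) / 2 = -1 - 1 by norm_num] at this
    · have := h2' m n; rwa [show ((1 : ℝ) - 7) / 2 = -1 - 2 by norm_num] at this
  set RB : ℝ := max (max r₃ (rK + 1)) 1 with hRB
  have hΔ₅ : ∀ y : E3, RB ≤ ‖y‖ →
      |(Δ (endValue e v)) y - 8⁻¹ * e.scalarCurvatureCoeff D y| ≤ (8 * K + 3 * K * C₃) * ‖y‖ ^ (-5 : ℝ) := by
    intro y hy
    obtain ⟨hlap, -⟩ := hΔsrc hC₃ hy h₃'
    rw [show (-1 - 4 : ℝ) = -5 by norm_num] at hlap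
    exact hlap.trans (mul_le_mul_of_nonneg_right (by nlinarith) (hpow0 y _))
  have hR₄ : ∀ y : E3, RB ≤ ‖y‖ → |e.scalarCurvatureCoeff D y| ≤ (8 * K + 3 * K * C₃) * ‖y‖ ^ (-4 : ℝ) := by
    intro y hy
    obtain ⟨-, hR⟩ := hΔsrc hC₃ hy h₃'
    exact hR.trans (mul_le_mul_of_nonneg_right (by nlinarith) (hpow0 y _))
  have hdec₃ : ∀ y : E3, RB ≤ ‖y‖ → |endValue e v y| ≤ C₃ * ‖y‖ ^ (-1 : ℝ) := fun y hy =>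
    (h₃' y (le_trans (le_trans (le_max_left _ _) (le_max_left _ _)) hy)).1
  /- ── the monopole term ── -/
  obtain ⟨A, C₄, R₄, h₄⟩ := e.exists_monopole_of_laplacian D hAF hρ0 hu hdec₃ hR₄ hΔ₅
  set C₄' : ℝ := max C₄ 0 with hC₄'
  have h₄' : ∀ y : E3, R₄ ≤ ‖y‖ → |endValue e v y - A * ‖y‖⁻¹| ≤ C₄' * ‖y‖ ^ (-(2 : ℝ)) :=
    fun y hy => (h₄ y hy).trans (mul_le_mul_of_nonneg_right (le_max_left _ _) (hpow0 y _))
  /- ── Stage 3: the bootstrap for `Ω = v̂ − A/r` ── -/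
  have hΩ : ContDiffOn ℝ ∞ (fun z => endValue e v z - A * ‖z‖⁻¹) {y : E3 | e.R < ‖y‖} :=
    hu.sub (contDiffOn_const.mul (contDiffOn_inv_norm hρ0))
  have heqΩ := fun (y : E3) (hy : e.R < ‖y‖) => sub_monopole_equation b (u := endValue e v)
      (g := fun y => 8⁻¹ * e.scalarCurvatureCoeff D y)
      (a := fun k l y => MetricCoord.ginv (e.hCoeff D) b.toBasis y l k)
      (β := fun m y => -(2⁻¹ * ∑ k, ∑ l, ∑ j, MetricCoord.ginv (e.hCoeff D) b.toBasis y k l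
            * MetricCoord.ginv (e.hCoeff D) b.toBasis y m j
            * MetricCoord.koszulCLM (e.hCoeff D) y (b k) (b l) (b j)))
      (c := fun y => -8⁻¹ * e.scalarCurvatureCoeff D y) hρ0 hu heq A hy
  have hg₃ : IsBigOSmooth 1 (-4) fun y ↦ 8⁻¹ * e.scalarCurvatureCoeff D y - A *
      (∑ k, ∑ l, (MetricCoord.ginv (e.hCoeff D) b.toBasis y l k - if k = l then 1 else 0)
          * fderiv ℝ (fun z => fderiv ℝ (fun z' : E3 => ‖z'‖⁻¹) z (b k)) y (b l)
        + ∑ m, (-(2⁻¹ * ∑ k, ∑ l, ∑ j, MetricCoord.ginv (e.hCoeff D) b.toBasis y k l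
            * MetricCoord.ginv (e.hCoeff D) b.toBasis y m j
            * MetricCoord.koszulCLM (e.hCoeff D) y (b k) (b l) (b j)))
          * fderiv ℝ (fun z' : E3 => ‖z'‖⁻¹) y (b m)
        + (-8⁻¹ * e.scalarCurvatureCoeff D y) * ‖y‖⁻¹) :=
    hg.sub (((e.isBigOSmooth_monopoleError_three D b hH3).const_mul A).mono (by norm_num))
  have hI₃ : ∀ x : E3, max (4 / 3 * R₄) 1 ≤ ‖x‖ →
      ∫ y in closedBall x (1 / 4 * ‖x‖), (endValue e v y - A * ‖y‖⁻¹) ^ 2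
        ≤ 6 * 64 * C₄' ^ 2 * ‖x‖ ^ (-1 : ℝ) := by
    intro x hx
    have h := setIntegral_quarterBall_sq_le (f := fun y => endValue e v y - A * ‖y‖⁻¹)
      (le_max_right _ _) zero_le_two (by norm_num) h₄' hx
    rwa [show (-(2 * 2) + 3 : ℝ) = -1 by norm_num] at h
  obtain ⟨C₅, r₅, hC₅, h₅⟩ := e.bootstrap_stage_three D b hH3 (u := fun z => endValue e v z - A * ‖z‖⁻¹)
    (q := -1) (by norm_num) hΩ hg₃ heqΩ (by positivity) hI₃
  have h₅' : ∀ y : E3, r₅ ≤ ‖y‖ → |endValue e v y - A * ‖y‖⁻¹| ≤ C₅ * ‖y‖ ^ (-2 : ℝ) ∧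
      (∀ m, |fderiv ℝ (fun z => endValue e v z - A * ‖z‖⁻¹) y (b m)| ≤ C₅ * ‖y‖ ^ (-3 : ℝ)) ∧
      (∀ m n, |fderiv ℝ (fun z => fderiv ℝ (fun z' => endValue e v z' - A * ‖z'‖⁻¹) z (b m)) y (b n)|
        ≤ C₅ * ‖y‖ ^ (-4 : ℝ)) := by
    intro y hy
    obtain ⟨h0, h1', h2'⟩ := h₅ y hy
    refine ⟨by rwa [show ((-1 : ℝ) - 3) / 2 = -2 by norm_num] at h0, fun m => ?_, fun m n => ?_⟩
    · have := h1' m; rwa [show ((-1 : ℝ) - 5) / 2 = -3 by norm_num] at this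
    · have := h2' m n; rwa [show ((-1 : ℝ) - 7) / 2 = -4 by norm_num] at this
  /- ── conclusion: the `O₂(r⁻²)` expansion ── -/
  refine ⟨A, fun m hm => ?_⟩
  have hfun : (fun y ↦ endValue e v y - A / ‖y‖) = fun z => endValue e v z - A * ‖z‖⁻¹ := by
    funext y; rw [div_eq_mul_inv]
  rw [hfun]
  have hev : ∀ᶠ x in cobounded E3, max r₅ (e.R + 1) < ‖x‖ := eventually_cobounded_lt_norm _
  interval_cases m
  · refine IsBigO.of_bound C₅ ?_
    filter_upwards [hev] with x hx
    have hx5 : r₅ ≤ ‖x‖ := by linarith [le_max_left r₅ (e.R + 1)]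
    rw [norm_norm, norm_iteratedFDeriv_zero, Real.norm_eq_abs, Real.norm_of_nonneg (hpow0 x _)]
    have h := (h₅' x hx5).1
    norm_num at h ⊢
    exact h
  · refine IsBigO.of_bound (3 * C₅) ?_
    filter_upwards [hev] with x hx
    have hx5 : r₅ ≤ ‖x‖ := by linarith [le_max_left r₅ (e.R + 1)]
    rw [norm_norm, Real.norm_of_nonneg (hpow0 x _)]
    have h := (h₅' x hx5).2.1
    calc ‖iteratedFDeriv ℝ 1 (fun z => endValue e v z - A * ‖z‖⁻¹) x‖
        ≤ ∑ i, |fderiv ℝ (fun z => endValue e v z - A * ‖z‖⁻¹) x (b i)| :=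
          norm_iteratedFDeriv_one_le_sum b _ x
      _ ≤ ∑ _i : Fin 3, C₅ * ‖x‖ ^ (-3 : ℝ) := Finset.sum_le_sum fun i _ => h i
      _ = 3 * C₅ * ‖x‖ ^ (-2 - ((1 : ℕ) : ℝ)) := by
          rw [Finset.sum_const, Finset.card_univ, Fintype.card_fin]
          norm_num
          ring
  · refine IsBigO.of_bound (9 * C₅) ?_
    filter_upwards [hev] with x hx
    have hx5 : r₅ ≤ ‖x‖ := by linarith [le_max_left r₅ (e.R + 1)]
    have hxR : e.R < ‖x‖ := by linarith [le_max_right r₅ (e.R + 1)]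
    rw [norm_norm, Real.norm_of_nonneg (hpow0 x _)]
    have h := (h₅' x hx5).2.2
    have hΩ2 : ContDiffAt ℝ 2 (fun z => endValue e v z - A * ‖z‖⁻¹) x :=
      (hΩ.contDiffAt (hU.mem_nhds hxR)).of_le (by norm_cast)
    calc ‖iteratedFDeriv ℝ 2 (fun z => endValue e v z - A * ‖z‖⁻¹) x‖
        ≤ ∑ i, ∑ j, |fderiv ℝ (fun z => fderiv ℝ (fun z' => endValue e v z' - A * ‖z'‖⁻¹) z (b j)) x (b i)| :=
          norm_iteratedFDeriv_two_le_sum b hΩ2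
      _ ≤ ∑ _i : Fin 3, ∑ _j : Fin 3, C₅ * ‖x‖ ^ (-4 : ℝ) :=
          Finset.sum_le_sum fun i _ => Finset.sum_le_sum fun j _ => h j i
      _ = 9 * C₅ * ‖x‖ ^ (-2 - ((2 : ℕ) : ℝ)) := by
          rw [Finset.sum_const, Finset.card_univ, Fintype.card_fin, Finset.sum_const,
            Finset.card_univ, Fintype.card_fin]
          norm_num
          ring

end Literature.Geometry.Lorentzian
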